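import Mathlib

/-!
# Tier4/Line3/FibreCount — sums over a map with finite fibres of constant size (L3.6a, the class-sum weights)

Blind re-derivation cell `pub-hodge-repro`, Tier 4 «PROVE THE STEP» (README §9–§10), LINE L3, seat t4-L3-p1 (prover);
support (S4d-2) of L3.6a `term_main_unfold` (lead S12253): the two counting steps of the class sum — the orbit map
`Γ′ → (class of w_c)`, `γ ↦ lines (γ • x_c)`, has fibres the cosets of the stabiliser (size `stabCard`), and the map
`Γ′ → ballActions`, `γ ↦ actM (M(γ))`, has fibres the cosets of the scalars (size `centerCard`).  Both are instances of
ONE Mathlib-level statement, proved here: for a map `F : A → B` whose fibres are all finite of cardinality `n`,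
`∑' a, g (F a) = n • ∑' b, g b` for every absolutely summable `g : B → ℂ`, and `g ∘ F` is absolutely summable
(`tsum_comp_eq_card_smul_tsum`, `summable_comp_of_fibres`).  The proof passes through `ℝ≥0∞`
(`ENNReal.tsum_sigma'` over `Equiv.sigmaFiberEquiv F`), where no summability is needed, then returns to `ℂ` with
`Summable.tsum_sigma` + `Equiv.tsum_eq`.

Nothing here asserts anything about the truth of (P); HC_CM is NOT proved by anyone in this repository.
-/

set_option autoImplicit false

noncomputable section

namespace Summit.Ventures.HodgeRepro.Tier4.Line3

open scoped ENNReal NNReal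

section FibreCount

variable {A B : Type*} (F : A → B)

/-- The sum of a function of `F` over `A`, as a sum over `B` of fibre sums (`ℝ≥0∞`, no summability needed). -/
theorem tsum_enorm_comp_eq (g : B → ℂ) :
    ∑' a, ‖g (F a)‖ₑ = ∑' b, ∑' _ : {a // F a = b}, ‖g b‖ₑ := by
  rw [← (Equiv.sigmaFiberEquiv F).tsum_eq (fun a => ‖g (F a)‖ₑ), ENNReal.tsum_sigma']
  refine tsum_congr fun b => tsum_congr fun x => ?_
  rw [show F ((Equiv.sigmaFiberEquiv F) ⟨b, x⟩) = b from x.2]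

/-- A fibre sum of a constant over a finite fibre of cardinality `n` is `n` times the constant (`ℝ≥0∞`). -/
theorem tsum_fibre_const {b : B} [Fintype {a // F a = b}] (c : ℝ≥0∞) :
    ∑' _ : {a // F a = b}, c = (Fintype.card {a // F a = b} : ℝ≥0∞) * c := by
  rw [tsum_fintype, Finset.sum_const, Finset.card_univ, nsmul_eq_mul]

/-- **ABSOLUTE SUMMABILITY DESCENDS ALONG A MAP WITH FINITE FIBRES OF CONSTANT SIZE.** -/
theorem summable_comp_of_fibres [∀ b, Fintype {a // F a = b}] (n : ℕ)
    (hn : ∀ b, Fintype.card {a // F a = b} = n) {g : B → ℂ} (hg : Summable fun b => ‖g b‖) :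
    Summable fun a => ‖g (F a)‖ := by
  rw [← tsum_enorm_ne_top_iff_summable_norm]
  rw [tsum_enorm_comp_eq F g]
  have h : ∀ b, ∑' _ : {a // F a = b}, ‖g b‖ₑ = (n : ℝ≥0∞) * ‖g b‖ₑ := fun b => by
    rw [tsum_fibre_const F, hn b]
  simp_rw [h]
  rw [ENNReal.tsum_mul_left]
  exact ENNReal.mul_ne_top (ENNReal.natCast_ne_top n) (tsum_enorm_ne_top_iff_summable_norm.mpr hg)

/-- **THE FIBRE COUNT**: `∑' a, g (F a) = n • ∑' b, g b` when every fibre of `F` has `n` elements. -/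
theorem tsum_comp_eq_card_smul_tsum [∀ b, Fintype {a // F a = b}] (n : ℕ)
    (hn : ∀ b, Fintype.card {a // F a = b} = n) {g : B → ℂ} (hg : Summable fun b => ‖g b‖) :
    ∑' a, g (F a) = (n : ℂ) * ∑' b, g b := by
  have hs : Summable fun a => g (F a) := Summable.of_norm (summable_comp_of_fibres F n hn hg)
  have hs' : Summable fun p : Σ b : B, {a // F a = b} => g (F ((Equiv.sigmaFiberEquiv F) p)) :=
    ((Equiv.sigmaFiberEquiv F).summable_iff).mpr hs
  rw [← (Equiv.sigmaFiberEquiv F).tsum_eq (fun a => g (F a)), hs'.tsum_sigma]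
  have h : ∀ b, (∑' x : {a // F a = b}, g (F ((Equiv.sigmaFiberEquiv F) ⟨b, x⟩))) = (n : ℂ) * g b := by
    intro b
    have : ∀ x : {a // F a = b}, g (F ((Equiv.sigmaFiberEquiv F) ⟨b, x⟩)) = g b := fun x => by
      simp only [Equiv.sigmaFiberEquiv, Equiv.coe_fn_mk, x.2]
    simp_rw [this]
    rw [tsum_fintype, Finset.sum_const, Finset.card_univ, hn b, nsmul_eq_mul]
  simp_rw [h]
  rw [tsum_mul_left]

end FibreCount

end Summit.Ventures.HodgeRepro.Tier4.Line3

end
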